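import Summits.HodgeConjecture.HodgeConjecture.Theorems.MarkmanPartnerTransportPartnerOfMinusTwoClass
import Literature.LinearAlgebra.QuadraticForm.WittCancellationCommonSummand
import Literature.LinearAlgebra.QuadraticForm.WittDecomposition
import Literature.AlgebraicGeometry.Surfaces.K3SurfaceProofs
import HarnessLib

/-!
# Route MarkmanPartnerTransport · support `PartnerExistence` (stmt-HodgeConjecture-19655) — «NS(X)_ℚ represents −2»
# from an isometric copy of the rational transcendental lattice inside `Λ_{K3} ⊗ ℚ` (Witt cancellation)

Cell hodge-nonav, planner p1 g36 (PICK 3 «X3′ AS A THEOREM», 2026-08-28T09:53:59Z), prover seat 20241-p1 (g12).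
SUPPORT FILE (`--supports stmt-HodgeConjecture-19655`, helper): pure lattice algebra on the tree's carriers; no
named fact, no definition, no sorry; credits nothing.

For a marked smooth projective `K3^{[2]}`-type fourfold `(X, φ, P, z)` let `N_ℚ ⊂ ℚ²³` be the rational
Néron–Severi space read through `φ` (`hNQ`) and `T_ℚ = N_ℚ^⊥` the rational transcendental space (for the
Beauville–Bogomolov form `q`). THEOREM `exists_minusTwo_of_ratTransc_equivalent`: if `(T_ℚ, q)` is isometric
to `(W, (·.·))` for some subspace `W ⊂ Λ_{K3} ⊗ ℚ = ℚ²²` (e.g. the rational transcendental lattice of a K3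
PARTNER, carried by the partner isometry), then some `v ∈ N_ℚ` has `q(v) = −2` — i.e. `RepresentsMinusTwo X φ`
in the sense of the rung «PARTNERED ∕ ORPHAN ρ = 3» (stated here with the predicate unfolded). Proof:
`ℚ²³ = Λ_ℚ ⊥ ⟨−2⟩` (`equivalent_bbfRat_prod`: the Gram matrix is `fromBlocks k3Gram 0 0 (−2)`), `ℚ²³ = N_ℚ ⊥ T_ℚ`
and `Λ_ℚ = W^⊥ ⊥ W` (orthogonal splittings, `equivalent_prod_restrict_orthogonal`; `W` is nondegenerate because
`T_ℚ` is), so `Λ_ℚ ⊥ ⟨−2⟩ ≅ N_ℚ ⊥ T_ℚ` and `Λ_ℚ ≅ W^⊥ ⊥ T_ℚ`, whence `N_ℚ ≅ ⟨−2⟩ ⊥ W^⊥` by Witt cancellation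
with a common summand (`equivalent_prod_of_common_summand`), and `N_ℚ` represents `−2`.

* §1 dictionary: `orthogonal_polarForm_toQuadraticMap` (`(2B)^⊥ = B^⊥`), `nondegenerate_polarForm_toQuadraticMap`,
  `equivalent_restrict_of_eq`, `nondegenerate_polarForm_of_equivalent`;
* §2 `equivalent_bbfRat_prod` — `(ℚ²³, q) ≅ (ℚ²², Λ_{K3}) ⊥ ⟨−2⟩`;
* §3 `exists_minusTwo_of_ratTransc_equivalent` — the theorem.

References: A. Beauville, J. Differential Geom. 18 (1983) §6 Prop. 6, §9 (`H²(S^{[2]},ℤ) = H²(S,ℤ) ⊕ ℤδ`, `q(δ) = −2`);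
M. Knebusch, *Specialization of Quadratic and Symmetric Bilinear Forms* (2010), Ch. 1 §1.2 Thm. 1.9; D. Huybrechts,
*Lectures on K3 Surfaces*, Ch. 3 Lemma 3.1, Ch. 14 §0.3.
-/

noncomputable section

set_option linter.dupNamespace false

open Module QuadraticMap
open Literature.AlgebraicGeometry Literature.AlgebraicGeometry.Motives Literature.AlgebraicGeometry.HodgeTheory
open Literature.AlgebraicGeometry.Hyperkaehler Literature.AlgebraicGeometry.Surfaces
open Literature.AlgebraicTopology.SingularHomology
open Literature.LinearAlgebra.QuadraticForm

namespace Summit.HodgeConjecture.HodgeConjecture.Theorems.MarkmanPartnerTransport.PartnerLattice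

/-- `MarkedK3Sq[X, φ, P, z]`: VERBATIM the `let MarkedK3Sq := …` binder of the route declarations of
MarkmanPartnerTransport (clauses (m1)–(m6)). Local notation only. -/
local notation3 (prettyPrint := false) "MarkedK3Sq[" X ", " φ ", " P ", " z "]" =>
  (((IsIntegralClass P ∧ ∀ Q : complexBetti X (2 * 4), IsIntegralClass Q → ∃ n : ℤ, Q = n • P) ∧
    (∀ c : complexBetti X 2, IsIntegralClass c ↔ ∃ v : K3HilbertIndex → ℤ, φ c = fun i => (v i : ℂ)) ∧
    (∀ a : complexBetti X 2, cupPowTwo a 4 = ((3 : ℂ) * (k3HilbertForm 2 (φ a) (φ a)) ^ 2) • P) ∧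
    (IsOfHodgeType 4 X 2 2 0 (LinearEquiv.symm φ z) ∧
      ∀ τ : complexBetti X 2, IsOfHodgeType 4 X 2 2 0 τ → ∃ t : ℂ, τ = t • LinearEquiv.symm φ z) ∧
    (∀ c : complexBetti X 2, IsOfHodgeType 4 X 2 1 1 c ↔
      (k3HilbertForm 2 (φ c) z = 0 ∧ k3HilbertForm 2 (φ c) (star z) = 0)) ∧
    (k3HilbertForm 2 z z = 0 ∧ 0 < (k3HilbertForm 2 (star z) z).re)))

/-- `qQ` = the rational Beauville–Bogomolov form of `K3^{[2]}`-type on `ℚ²³` (as in `…PartnerExistenceLattice`). -/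
local notation3 (prettyPrint := false) "qQ" => Matrix.toBilin' (Matrix.map (k3HilbertGram 2) (Int.cast : ℤ → ℚ))

/-! ### §1 Dictionary: bilinear forms versus their quadratic forms -/

section Dictionary

variable {V : Type*} [AddCommGroup V] [Module ℚ V]

/-- The polar form of `B.toQuadraticMap` is `(x, y) ↦ B x y + B y x`, i.e. `2B` for symmetric `B`. [folklore] -/
private theorem polarForm_toQuadraticMap_apply (B : LinearMap.BilinForm ℚ V) (hB : B.IsSymm) (x y : V) :
    polarForm B.toQuadraticMap x y = 2 * B x y := by
  change QuadraticMap.polar (LinearMap.BilinMap.toQuadraticMap B) x y = _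
  rw [LinearMap.BilinMap.polar_toQuadraticMap, hB.eq y x, two_mul]

/-- For a symmetric bilinear form `B` over `ℚ`, the orthogonal complements for the polar form of `B.toQuadraticMap`
(`= 2B`) are those for `B`. [folklore] -/
private theorem orthogonal_polarForm_toQuadraticMap (B : LinearMap.BilinForm ℚ V) (hB : B.IsSymm)
    (W : Submodule ℚ V) : (polarForm B.toQuadraticMap).orthogonal W = B.orthogonal W := by
  ext m
  simp only [LinearMap.BilinForm.mem_orthogonal_iff]
  refine forall₂_congr fun n _ ↦ ?_
  change polarForm B.toQuadraticMap n m = 0 ↔ B n m = 0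
  rw [polarForm_toQuadraticMap_apply B hB, mul_eq_zero]
  simp

/-- A symmetric bilinear form over `ℚ` with trivial left radical is nondegenerate. [folklore] -/
private theorem nondegenerate_of_isSymm_of_left {B : LinearMap.BilinForm ℚ V} (hB : B.IsSymm)
    (h : ∀ m : V, (∀ n : V, B m n = 0) → m = 0) : B.Nondegenerate :=
  ⟨fun m hm ↦ h m hm, fun m hm ↦ h m fun n ↦ by rw [hB.eq]; exact hm n⟩

/-- For a symmetric nondegenerate bilinear form `B` over `ℚ`, the polar form of `B.toQuadraticMap` is
nondegenerate. [folklore] -/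
private theorem nondegenerate_polarForm_toQuadraticMap (B : LinearMap.BilinForm ℚ V) (hB : B.IsSymm)
    (h : B.Nondegenerate) : (polarForm B.toQuadraticMap).Nondegenerate := by
  refine nondegenerate_of_isSymm_of_left (polarForm_isSymm _) fun m hm ↦ h.1 m fun n ↦ ?_
  have h1 := hm n
  rw [polarForm_toQuadraticMap_apply B hB, mul_eq_zero] at h1
  simpa using h1

/-- For a symmetric bilinear form `B` over `ℚ`, if the polar form of `B.toQuadraticMap` (`= 2B`) is nondegenerate
then so is `B`. [folklore] -/
private theorem nondegenerate_of_polarForm_toQuadraticMap (B : LinearMap.BilinForm ℚ V) (hB : B.IsSymm)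
    (h : (polarForm B.toQuadraticMap).Nondegenerate) : B.Nondegenerate := by
  refine nondegenerate_of_isSymm_of_left hB fun m hm ↦ h.1 m fun n ↦ ?_
  rw [polarForm_toQuadraticMap_apply B hB, hm n, mul_zero]

/-- Restrictions of a quadratic form to equal subspaces are isometric. [folklore] -/
private theorem equivalent_restrict_of_eq (Q : QuadraticForm ℚ V) {W W' : Submodule ℚ V} (h : W = W') :
    (Q.restrict W).Equivalent (Q.restrict W') := by
  subst h
  exact QuadraticMap.Equivalent.refl _

/-- Nondegeneracy of the polar form passes along an isometry equivalence. [folklore] -/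
private theorem nondegenerate_polarForm_of_equivalent {V' : Type*} [AddCommGroup V'] [Module ℚ V']
    {Q : QuadraticForm ℚ V} {Q' : QuadraticForm ℚ V'} (e : Q.Equivalent Q')
    (h : (polarForm Q).Nondegenerate) : (polarForm Q').Nondegenerate := by
  obtain ⟨e⟩ := e
  have hpol : ∀ x y : V, polar Q' (e x) (e y) = polar Q x y := fun x y ↦ by
    simp only [QuadraticMap.polar, ← map_add, e.map_app]
  refine nondegenerate_of_isSymm_of_left (polarForm_isSymm _) fun m hm ↦ ?_
  have h0 : e.symm m = 0 := by
    refine h.1 _ fun n ↦ ?_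
    have h1 := hm (e n)
    rw [polarForm_apply] at h1 ⊢
    rw [← hpol, QuadraticMap.IsometryEquiv.apply_symm_apply]
    exact h1
  simpa using congrArg e h0

end Dictionary

/-! ### §2 `ℚ²³ = Λ_ℚ ⊥ ⟨−2⟩` -/

/-- **The rational Beauville–Bogomolov form of `K3^{[2]}`-type is `Λ_{K3} ⊗ ℚ ⊥ ⟨−2⟩`**
(`k3HilbertGram 2 = fromBlocks k3Gram 0 0 (−2)` on `K3Index ⊕ Unit`; Beauville: `H²(S^{[2]},ℤ) = H²(S,ℤ) ⊕ ℤδ`,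
`q(δ) = −2`). [cite: Beauville1983, §6 Prop. 6 and §9 Rem. 1] -/
theorem equivalent_bbfRat_prod :
    (qQ).toQuadraticMap.Equivalent
      (k3FormRat.toQuadraticMap.prod ((-2 : ℚ) • (QuadraticMap.sq : QuadraticForm ℚ ℚ))) := by
  let e : (K3HilbertIndex → ℚ) ≃ₗ[ℚ] (K3Index → ℚ) × ℚ :=
    (LinearEquiv.sumArrowLequivProdArrow K3Index Unit ℚ ℚ).trans
      (LinearEquiv.prodCongr (LinearEquiv.refl ℚ _) (LinearEquiv.funUnique Unit ℚ ℚ))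
  refine ⟨{ toLinearEquiv := e, map_app' := fun v => ?_ }⟩
  change k3FormRat.toQuadraticMap (fun i => v (Sum.inl i)) + (-2 : ℚ) • QuadraticMap.sq (v (Sum.inr default)) =
    (qQ).toQuadraticMap v
  rw [LinearMap.BilinMap.toQuadraticMap_apply, LinearMap.BilinMap.toQuadraticMap_apply, QuadraticMap.sq_apply,
    qQ_eq_k3FormRat_sub, smul_eq_mul]
  ring

/-! ### §3 `N_ℚ` represents `−2` as soon as `T_ℚ` sits isometrically inside `Λ_ℚ` -/

variable {X : SchemeOver ℂ} {φ : complexBetti X 2 ≃ₗ[ℂ] (K3HilbertIndex → ℂ)} {P : complexBetti X (2 * 4)}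
  {z : K3HilbertIndex → ℂ} {NQ : Submodule ℚ (K3HilbertIndex → ℚ)}

/-- **If the rational transcendental lattice `(T_ℚ, q)` of a marked `K3^{[2]}`-type fourfold is isometric to a
subspace of `Λ_{K3} ⊗ ℚ`, then `N_ℚ = NS(X)_ℚ` represents `−2`** (Witt cancellation: `Λ ⊥ ⟨−2⟩ ≅ N_ℚ ⊥ T_ℚ`,
`Λ ≅ W^⊥ ⊥ W ≅ W^⊥ ⊥ T_ℚ`). The conclusion is `RepresentsMinusTwo X φ` of the rung «PARTNERED ∕ ORPHAN ρ = 3»,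
unfolded. [cite: Knebusch2010, Ch. 1 §1.2 Thm. 1.9] [cite: Beauville1983, §9 Rem. 1] [cite: Huybrechts2016K3, Ch. 3 Lemma 3.1] -/
theorem exists_minusTwo_of_ratTransc_equivalent (hX : IsSmoothProjective 4 X) (hM : MarkedK3Sq[X, φ, P, z])
    (hNQ : ∀ v, v ∈ NQ ↔ φ.symm (fun i => (v i : ℂ)) ∈ algebraicClasses X 1)
    (W : Submodule ℚ (K3Index → ℚ))
    (hT : ((qQ).restrict ((qQ).orthogonal NQ)).toQuadraticMap.Equivalent (k3FormRat.restrict W).toQuadraticMap) :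
    ∃ v : K3HilbertIndex → ℚ, φ.symm (fun i => ((v i : ℚ) : ℂ)) ∈ algebraicClasses X 1 ∧
      k3HilbertForm 2 (fun i => ((v i : ℚ) : ℂ)) (fun i => ((v i : ℚ) : ℂ)) = -2 := by
  classical
  have hqs : LinearMap.BilinForm.IsSymm (qQ) := ⟨fun a b ↦ qQ_comm a b⟩
  -- the three quadratic forms
  set Q : QuadraticForm ℚ (K3HilbertIndex → ℚ) := (qQ).toQuadraticMap with hQdef
  set K : QuadraticForm ℚ (K3Index → ℚ) := k3FormRat.toQuadraticMap with hKdef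
  set D : QuadraticForm ℚ ℚ := (-2 : ℚ) • (QuadraticMap.sq : QuadraticForm ℚ ℚ) with hDdef
  set TQ : Submodule ℚ (K3HilbertIndex → ℚ) := (qQ).orthogonal NQ with hTQdef
  -- nondegeneracy of `N_ℚ` and `T_ℚ`
  have hNnd : ((qQ).restrict NQ).Nondegenerate :=
    LinearMap.BilinForm.nondegenerate_restrict_of_disjoint_orthogonal _ qQ_isRefl
      (disjoint_iff.2 (ratNeronSeveri_inf_orthogonal_eq_bot hX hM hNQ))
  have hTnd : ((qQ).restrict TQ).Nondegenerate := restrict_ratTransc_nondegenerate hX hM hNQ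
  have hNsymm : ((qQ).restrict NQ).IsSymm := ⟨fun a b ↦ qQ_comm _ _⟩
  have hTsymm : ((qQ).restrict TQ).IsSymm := ⟨fun a b ↦ qQ_comm _ _⟩
  have hNdeg : (polarForm (Q.restrict NQ)).Nondegenerate :=
    nondegenerate_polarForm_toQuadraticMap _ hNsymm hNnd
  have hTdeg : (polarForm (Q.restrict TQ)).Nondegenerate :=
    nondegenerate_polarForm_toQuadraticMap _ hTsymm hTnd
  -- `h₁ : Λ ⊥ ⟨−2⟩ ≅ N_ℚ ⊥ T_ℚ`
  have hcN : IsCompl NQ ((polarForm Q).orthogonal NQ) := by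
    rw [hQdef, orthogonal_polarForm_toQuadraticMap _ hqs]
    exact isCompl_ratNeronSeveri_orthogonal hX hM hNQ
  have h₁ : (K.prod D).Equivalent ((Q.restrict NQ).prod (Q.restrict TQ)) :=
    equivalent_bbfRat_prod.symm.trans <| (equivalent_prod_restrict_orthogonal hcN).trans <|
      (QuadraticMap.Equivalent.refl _).prod
        (equivalent_restrict_of_eq Q (by rw [hQdef, orthogonal_polarForm_toQuadraticMap _ hqs]))
  -- `h₂ : Λ ≅ W^⊥ ⊥ T_ℚ`
  have hWdeg : (polarForm (K.restrict W)).Nondegenerate := nondegenerate_polarForm_of_equivalent hT hTdeg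
  have hWsymm : (k3FormRat.restrict W).IsSymm := ⟨fun a b ↦ k3FormRat_isSymm.eq _ _⟩
  have hWnd : (k3FormRat.restrict W).Nondegenerate := nondegenerate_of_polarForm_toQuadraticMap _ hWsymm hWdeg
  have hcW : IsCompl W ((polarForm K).orthogonal W) := by
    rw [hKdef, orthogonal_polarForm_toQuadraticMap _ k3FormRat_isSymm]
    exact (LinearMap.BilinForm.restrict_nondegenerate_iff_isCompl_orthogonal k3FormRat_isSymm.isRefl).1 hWnd
  have hcomm : ((K.restrict W).prod (K.restrict ((polarForm K).orthogonal W))).Equivalent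
      ((K.restrict ((polarForm K).orthogonal W)).prod (K.restrict W)) :=
    ⟨QuadraticMap.IsometryEquiv.prodComm _ _⟩
  have h₂ : K.Equivalent ((K.restrict ((polarForm K).orthogonal W)).prod (Q.restrict TQ)) :=
    (equivalent_prod_restrict_orthogonal hcW).trans <| hcomm.trans <|
      (QuadraticMap.Equivalent.refl _).prod hT.symm
  -- Witt cancellation and the representing vector
  have hN : (Q.restrict NQ).Equivalent (D.prod (K.restrict ((polarForm K).orthogonal W))) :=
    equivalent_prod_of_common_summand hTdeg hNdeg h₁ h₂
  obtain ⟨n, hn⟩ := exists_apply_eq_of_equivalent_prod hN (1 : ℚ)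
  refine ⟨n, (hNQ _).1 n.2, ?_⟩
  have hval : qQ (n : K3HilbertIndex → ℚ) n = -2 := by
    have h2 : (Q.restrict NQ) n = -2 := by rw [hn, hDdef]; simp
    exact h2
  rw [k3HilbertForm_ratCast, hval]
  norm_num

end Summit.HodgeConjecture.HodgeConjecture.Theorems.MarkmanPartnerTransport.PartnerLattice

end
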